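import Summits.BirchSwinnertonDyer.Rank1Residual.O5.HeegnerLogTransportThreeOrdCompanion
import Literature.NumberTheory.EllipticCurves.HeegnerPointFiniteIndex
import HarnessLib
import HarnessLib.Audit.Tags

/-!
# Heegner-log transport at `p = 3` (KL3), part 4 (continued): the finite-index binder from Kolyvagin + Mordell–Weil (§1b), the companion side at a
# good ORDINARY `3` from Yan–Zhu 2026 Thm. 4.15 (§3), the composition with the W-side chain (§4) and its Kolyvagin form (§4b) — o5-r2 GEN 17

HONEST FRAMING (cell `b2b-bsdres`, run/shared/lean/b2b/bsd-rank1-residual/, verbatim in every file): the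
goal of the cell is to DELETE the COMBINATION-SHAPED residual classes of the Birch–Swinnerton-Dyer formula
for ALL analytic-rank `≤ 1` elliptic curves over `ℚ` — "full BSD formula for every rank `≤ 1` curve in
class `C`" assembled STRICTLY from published theorems — so that the rank-`≤ 1` remainder becomes exactly
the CONSTRUCTION-SHAPED classes, which are TYPED (missing-input `Prop`s), NOT attempted. This is not
"finishing BSD". Team O5 (tame potentially supersingular additive `p = 3`, (t′)), planner o5-r2 (the
non-Iwasawa side), GEN 17; RESEARCH ROUTE; THEOREMS ONLY (bookkeeping over explicit hypotheses); no named
fact, no definition of a new object, no conjecture node is introduced; NOTHING is booked and no mark of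
`RESIDUAL-MAP.md` moves.

Sibling of `O5/HeegnerLogTransportThreeOrdCompanion.lean` (p343587: the module text of the source v1 + §1–§2, which applies here verbatim); source
`HOME/b2b-bsdres-o5-r2/gen17/lean/GoodOrdCompanionThree.lean` v2 sha16 `643f113dad2ef255` (547 l.; v1 `15549451a2e009ba` 426 l. ⊂ v2 verbatim; o5-r2 GEN 17 `gen17/SHA16.txt`; HOME/INBOX.md l.13534 + ADDENDUM 1 l.13561; `cells/o5o6/TARGETS.md` `#### o5-r2 GEN 17` l.2455 + ADDENDUM 1).
This file = v2's §1b + §3 + §4 + §4b; typer of record cc-typer-5 GEN 18 (by-name ask A-O5-G17-1 as amended 'now = land v2').  v2's additions to the module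
text, verbatim:

* §1b `index_zmultiples_ne_zero_of_finrank_eq_one`, `index_zmultiples_ne_zero_of_kolyvagin` — the
  finite-index binder `[G(K) : ℤP′] ≠ 0` carried by §1/§3/§4 is DISCHARGED from Kolyvagin's theorem
  (tree named fact `kolyvagin`: `rank G(K) = 1`, hypothesis `hKo`) and the Mordell–Weil theorem (PROVED in
  the tree, `WeierstrassCurve.module_finite_point_holds`): a non-torsion element of a finitely generated
  `ℤ`-module of rank `1` generates a finite-index subgroup (rank count + "f.g. torsion ⇒ finite").
  §4b `o5_index_unit_of_goodOrd_companion_of_kolyvagin` is §4 with the finite-index binder replaced by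
  Kolyvagin's theorem (`hKo`, §1b).

PLACEMENT: §3, §4, §4b = the source's declaration blocks BYTE-IDENTICAL and in source order; §1b = o5-r2's two names, docstrings and STATEMENTS verbatim with
the proofs replaced by one-line DEDUP aliases of the tree lemmas `Literature.NumberTheory.EllipticCurves.index_zmultiples_ne_zero_of_finrank_eq_one` /
`…index_zmultiples_ne_zero_of_isHeegnerPoint` (`Literature/NumberTheory/EllipticCurves/HeegnerPointFiniteIndex.lean`, p344022: the typer's kernel answer to
D-O5-G17-2 'can the tree state `index_ne_zero_of_isHeegnerPoint`?', filed minutes before v2's ADDENDUM 1 reached the bus — same mathematics: Mordell–Weil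
`addGroup_fg_point_holds` + rank–nullity for the quotient by `ℤx` + 'f.g. torsion ⇒ finite'); in v2 the §1b block sits inside §1 (between
`not_isOfFinAddOrder_nsmul` and `companion_logUnit_of_index_unit`, both already landed in part A), here it opens this file — order is the only
difference.  THEOREMS ONLY: 0 `def`, 0 `@[conjecture]` node, 0 Literature facts (net named-fact debt 0), no `sorry`; every published input stays an
explicit binder (`hYZ` = the tree's NAMED FACT `YanZhu2026.thm415_padicValRat_bsd_rank_le_one`, PUB*, flag `YZ26@3-BF-ERL-Ohta`, via `Partition.RowC16.bsdp`;
`hW20`, `hmod`, `hGZK`, `hKo : kolyvagin N′ G K`, `hA : KrizLiUnitBitTransportThree` = KL3-A).  What this does NOT do (source): it does not prove KL3-D as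
typed; for SUPERSINGULAR companions KL3-D stays OPEN (= RESIDUAL-MAP §B X6/X7/X8 for the rank-0 twist); every use inherits the flag of the named fact;
research route, lane CLASS-CLOSURE §3.5 O5; nothing booked; no mark of `RESIDUAL-MAP.md` moves; census C-KL3-V = EVIDENCE only; O5 OPEN.

References: X. Yan, X. Zhu, J. Algebra 693 (2026) Thm. 4.15 [YanZhu2024MainConjNonCM]; D. Kriz, C. Li, Forum Math. Sigma 7 (2019) e15, Thm. 1.16 [KrizLi2019];
B. H. Gross, LMS LN 153 (1991) Conj. 1.2, Prop. 2.1 [GrossLMS1991] and Thm. 1.3 (Kolyvagin) [Gross1991]; J. H. Silverman, AEC, Thm. VIII.6.7 [SilvermanAEC2009];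
F. Castella, Math. Ann. 370 (2018) Thm. 2.3 [Castella2018]; C. Wuthrich, LMS LN 414 (2014) Lemma 20 [Wuthrich2014]; HOME/b2b-bsdres-o5-r2/gen17/O5-GEN17.md (E-KL3-2).
-/

noncomputable section

open scoped Classical

open WeierstrassCurve Literature.NumberTheory.EllipticCurves
  Literature.NumberTheory.EllipticCurves.ModularForms
  Literature.NumberTheory.EllipticCurves.Rank1Residual
  Literature.NumberTheory.EllipticCurves.Rank1Residual.Typed

namespace Summit.BirchSwinnertonDyer.Rank1Residual.O5.HeegnerLogTransport

open Summit.BirchSwinnertonDyer.Rank1Residual.X11b (padicLogOrd embAt padicPointOf)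
open Summit.BirchSwinnertonDyer.Rank1Residual.X11b.LocalIndex (psi
  exists_addEquiv_valuation_psi_padicPointOf valuation_psi_zsmul_add)
open Literature.NumberTheory.EllipticCurves.Rank1Residual (Addv)
open IsDedekindDomain (HeightOneSpectrum)
open scoped NumberField

/-! ## §1b The finite-index binder from Kolyvagin + Mordell–Weil -/

/-- In a finitely generated `ℤ`-module of rank `1`, a non-torsion element generates a subgroup of finite
index: every `m` has a nonzero multiple in `ℤx` (else `x, m` are `ℤ`-independent and the rank is `≥ 2`,
`LinearIndependent.fintype_card_le_finrank`), so the quotient is a finitely generated torsion `ℤ`-module,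
hence finite (`Module.finite_of_fg_torsion`). [folklore]  DEDUP ⟦cc-typer-5 GEN 18⟧: PROVED in the tree as `Literature.NumberTheory.EllipticCurves.index_zmultiples_ne_zero_of_finrank_eq_one`
(`Literature/NumberTheory/EllipticCurves/HeegnerPointFiniteIndex.lean`, p344022 — the typer's answer to D-O5-G17-2, filed before v2 was announced);
kept here under o5-r2's name with o5-r2's statement VERBATIM as a one-line alias, so that §4b below is byte-identical to the source. -/
theorem index_zmultiples_ne_zero_of_finrank_eq_one {M : Type*} [AddCommGroup M] [Module.Finite ℤ M]
    (h1 : Module.finrank ℤ M = 1) {x : M} (hx : ¬ IsOfFinAddOrder x) :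
    (AddSubgroup.zmultiples x).index ≠ 0 := by
  haveI : AddGroup.FG M := Module.Finite.iff_addGroup_fg.mp ‹_›
  exact Literature.NumberTheory.EllipticCurves.index_zmultiples_ne_zero_of_finrank_eq_one hx h1

/-- **Kolyvagin ⇒ the Heegner point has finite index.** For `E/ℚ` (model `W`), an imaginary quadratic
`K` satisfying the Heegner hypothesis at level `N` and a Heegner point `P ∈ E(K)` of infinite order,
Kolyvagin's theorem (tree named fact `kolyvagin`, hypothesis `hKo`: `rank E(K) = 1`) and the Mordell–Weil
theorem (`WeierstrassCurve.module_finite_point_holds`, proved in the tree) give `[E(K) : ℤP] ≠ 0`, i.e.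
`ℤP` has finite index — the binder `hI0` of §1/§3/§4 and of KL3-D. [cite: Gross1991, Thm. 1.3]
[cite: SilvermanAEC2009, Thm. VIII.6.7]  DEDUP ⟦cc-typer-5 GEN 18⟧: PROVED in the tree as `Literature.NumberTheory.EllipticCurves.index_zmultiples_ne_zero_of_isHeegnerPoint`
(`Literature/NumberTheory/EllipticCurves/HeegnerPointFiniteIndex.lean`, p344022 — the typer's answer to D-O5-G17-2, filed before v2 was announced);
kept here under o5-r2's name with o5-r2's statement VERBATIM as a one-line alias, so that §4b below is byte-identical to the source. -/
theorem index_zmultiples_ne_zero_of_kolyvagin {N : ℕ} [NeZero N] (W : WeierstrassCurve ℚ) [W.IsElliptic]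
    (K : Type) [Field K] [NumberField K] (hKo : kolyvagin N W K) (hK : IsImaginaryQuadratic K)
    (hH : SatisfiesHeegnerHypothesis N K) {P : (W.baseChange K).toAffine.Point}
    (hP : IsHeegnerPoint N W K P) (hnt : ¬ IsOfFinAddOrder P) :
    (AddSubgroup.zmultiples P).index ≠ 0 := by
  exact Literature.NumberTheory.EllipticCurves.index_zmultiples_ne_zero_of_isHeegnerPoint N W K hKo hK hH hP hnt

/-! ## §3 The companion side at a good ORDINARY 3 from Yan–Zhu 2026 Thm. 4.15 (row C16 of the partition) -/

/-- **KL3-D's conclusion for a good ORDINARY companion, from print (E-KL3-2).** GRANTED, as explicit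
hypotheses, the published inputs Yan–Zhu 2026 Thm. 4.15 (`hYZ`, PUB*, flag `YZ26@3-BF-ERL-Ohta`),
Wuthrich 2014 Lemma 20 (`hW20`), modularity (`hmod`), Gross–Zagier–Kolyvagin (`hGZK`): let `G/ℚ` be
globally minimal in row C16 at `3` (good ORDINARY at `3`, `ρ̄_{G,3}` irreducible, surj(3) ∨ ram) of
analytic rank `≤ 1`, `Gd` a globally minimal model of `G^{(d_K)}` also in row C16 at `3` of analytic
rank `≤ 1` (`K` imaginary quadratic), `P′ ∈ G(K)` of infinite order generating a subgroup of finite index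
(intended: the Heegner point of the datum `D′`, finite index by Kolyvagin), `Q ∈ G(K)` of infinite order
`3`-primitive at `ι₃`, and the per-pair census data — the STEP-0 identity of the analytic orders at the
pair (`hstep0`), both analytic orders `3`-units (`hu₀`, `hu₁`: what the census COMPUTES), `3 ∤ ∏ c_q(G)`,
`3 ∤ c_{D′}`. THEN the normalised Heegner logarithm is a `3`-adic unit,
`ord₃ log_{ω_G} P′ + ord₃ #G̃(𝔽₃) − 1 = 0`, AND `Ш(G/K)[3^∞] = 0`. Route: row C16 gives `BSD(G,3)` and
`BSD(Gd,3)` (`RowC16.bsdp`), hence Miller's `MissingPPartAt` for both; §2 gives `3 ∤ [G(K):ℤP′]` and the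
`Ш` statement; §1 transfers primitivity from `Q` to `P′`. This is the input `hGunit` of the W-side chain
of GEN 16 — for ORDINARY companions no open conjecture is imported (GEN 16's label "OPEN = Wan₃" for
KL3-D is superseded on this sub-case; for SUPERSINGULAR companions KL3-D stays open).
[cite: YanZhu2024MainConjNonCM, Thm. 4.15 (§4.6) = Cor. 1.4] [cite: Wuthrich2014, Lemma 20 (p. 399)]
[cite: GrossLMS1991, §1 Conj. 1.2 (p. 237)] [cite: Castella2018, proof of Thm. 2.3, (calcul) (arXiv:1704.06608 p. 6)] -/
theorem goodOrd_companion_logUnit_three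
    (hYZ : YanZhu2026.thm415_padicValRat_bsd_rank_le_one)
    (hW20 : Wuthrich2014.lemma20_surjective_threeAdic_of_semistable)
    (hmod : hasEntireLFunction_rat) (hGZK : rank_eq_analyticRank_of_analyticRank_le_one)
    (G : WeierstrassCurve ℚ) [G.IsElliptic] [G.IsGloballyMinimal] (hrG : G.analyticRank ≤ 1)
    (hC16 : RowC16 G 3)
    (Gd : WeierstrassCurve ℚ) [Gd.IsElliptic] [Gd.IsGloballyMinimal] (hrGd : Gd.analyticRank ≤ 1)
    (hC16d : RowC16 Gd 3)
    (K : Type) [Field K] [NumberField K] (hK : IsImaginaryQuadratic K)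
    (hGd : ∃ C : VariableChange ℚ, C • G.quadraticTwist (NumberField.discr K : ℚ) = Gd)
    (ι₃ : K →+* ℚ_[3]) (P' Q : (G.baseChange K).toAffine.Point)
    (hP' : ¬ IsOfFinAddOrder P') (hQ : ¬ IsOfFinAddOrder Q)
    (hI0 : (AddSubgroup.zmultiples P').index ≠ 0)
    (hQunit : padicLogOrd G 3 ι₃ Q + padicValInt 3 (nsCount G 3) - 1 = 0)
    {N' : ℕ} [NeZero N'] (D' : ModularParametrizationData G N')
    {q₀ q₁ : ℚ} (hq₀ : shaAn G = (q₀ : ℂ)) (hq₁ : shaAn Gd = (q₁ : ℂ))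
    (hstep0 : padicValRat 3 q₀ + padicValRat 3 q₁ + ((2 * padicValNat 3 G.tamagawaProduct : ℕ) : ℤ) +
        ((2 * padicValInt 3 D'.maninConstant : ℕ) : ℤ) =
      ((2 * padicValNat 3 (AddSubgroup.zmultiples P').index : ℕ) : ℤ))
    (hu₀ : padicValRat 3 q₀ = 0) (hu₁ : padicValRat 3 q₁ = 0)
    (htam : ¬ 3 ∣ G.tamagawaProduct) (hcD' : padicValInt 3 D'.maninConstant = 0) :
    padicLogOrd G 3 ι₃ P' + padicValInt 3 (nsCount G 3) - 1 = 0 ∧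
      Nat.card (AddCommGroup.primaryComponent (G.baseChange K).sha 3) = 1 := by
  haveI : Finite G.sha := (hGZK G hrG).2
  haveI : Finite Gd.sha := (hGZK Gd hrGd).2
  have hBG : BSDp G 3 := RowC16.bsdp hYZ hW20 hmod hGZK hrG hC16
  have hBGd : BSDp Gd 3 := RowC16.bsdp hYZ hW20 hmod hGZK hrGd hC16d
  have hMG : MissingPPartAt G 3 := missingPPartAt_of_bsdp G 3 hBG
  have hMGd : MissingPPartAt Gd 3 := missingPPartAt_of_bsdp Gd 3 hBGd
  obtain ⟨hI, hsha⟩ := padicValNat_index_eq_zero_of_missingPPartAt_pair G Gd K hK hGd 3 (by decide)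
    hMG hMGd P' hq₀ hq₁ hstep0 hu₀ hu₁ (padicValNat.eq_zero_of_not_dvd htam) hcD'
  exact ⟨companion_logUnit_of_index_unit G hC16.2.1.1 ι₃ P' Q hP' hQ hI0 hI hQunit, hsha⟩

/-- **The same with KL3-D's own hypothesis `Ш(G/K)[3^∞] = 0`** in place of the two analytic `3`-units
(they are equivalent given row C16 for both members: `padicValRat_shaAn_pair_eq_zero_of_sha_trivial`).
So KL3-D `GoodHeegnerLogUnitThree` RESTRICTED to good ORDINARY companions in row C16 (with the twist in
row C16, both analytic ranks `≤ 1`, and the Heegner point of finite index — Kolyvagin) follows from the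
published inputs named; nothing open is used on this sub-case. [cite: YanZhu2024MainConjNonCM, Thm. 4.15 (§4.6) = Cor. 1.4]
[cite: GrossLMS1991, §1 Conj. 1.2 (p. 237)] -/
theorem goodOrd_companion_logUnit_three_of_sha
    (hYZ : YanZhu2026.thm415_padicValRat_bsd_rank_le_one)
    (hW20 : Wuthrich2014.lemma20_surjective_threeAdic_of_semistable)
    (hmod : hasEntireLFunction_rat) (hGZK : rank_eq_analyticRank_of_analyticRank_le_one)
    (G : WeierstrassCurve ℚ) [G.IsElliptic] [G.IsGloballyMinimal] (hrG : G.analyticRank ≤ 1)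
    (hC16 : RowC16 G 3)
    (Gd : WeierstrassCurve ℚ) [Gd.IsElliptic] [Gd.IsGloballyMinimal] (hrGd : Gd.analyticRank ≤ 1)
    (hC16d : RowC16 Gd 3)
    (K : Type) [Field K] [NumberField K] (hK : IsImaginaryQuadratic K)
    (hGd : ∃ C : VariableChange ℚ, C • G.quadraticTwist (NumberField.discr K : ℚ) = Gd)
    (ι₃ : K →+* ℚ_[3]) (P' Q : (G.baseChange K).toAffine.Point)
    (hP' : ¬ IsOfFinAddOrder P') (hQ : ¬ IsOfFinAddOrder Q)
    (hI0 : (AddSubgroup.zmultiples P').index ≠ 0)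
    (hQunit : padicLogOrd G 3 ι₃ Q + padicValInt 3 (nsCount G 3) - 1 = 0)
    {N' : ℕ} [NeZero N'] (D' : ModularParametrizationData G N')
    {q₀ q₁ : ℚ} (hq₀ : shaAn G = (q₀ : ℂ)) (hq₁ : shaAn Gd = (q₁ : ℂ))
    (hstep0 : padicValRat 3 q₀ + padicValRat 3 q₁ + ((2 * padicValNat 3 G.tamagawaProduct : ℕ) : ℤ) +
        ((2 * padicValInt 3 D'.maninConstant : ℕ) : ℤ) =
      ((2 * padicValNat 3 (AddSubgroup.zmultiples P').index : ℕ) : ℤ))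
    (hsha : Nat.card (AddCommGroup.primaryComponent (G.baseChange K).sha 3) = 1)
    (htam : ¬ 3 ∣ G.tamagawaProduct) (hcD' : padicValInt 3 D'.maninConstant = 0) :
    padicLogOrd G 3 ι₃ P' + padicValInt 3 (nsCount G 3) - 1 = 0 := by
  haveI : Finite G.sha := (hGZK G hrG).2
  haveI : Finite Gd.sha := (hGZK Gd hrGd).2
  have hMG : MissingPPartAt G 3 := missingPPartAt_of_bsdp G 3 (RowC16.bsdp hYZ hW20 hmod hGZK hrG hC16)
  have hMGd : MissingPPartAt Gd 3 :=
    missingPPartAt_of_bsdp Gd 3 (RowC16.bsdp hYZ hW20 hmod hGZK hrGd hC16d)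
  obtain ⟨hu₀, hu₁⟩ := padicValRat_shaAn_pair_eq_zero_of_sha_trivial G Gd K hK hGd 3 (by decide) hMG hMGd
    hq₀ hq₁ hsha
  exact (goodOrd_companion_logUnit_three hYZ hW20 hmod hGZK G hrG hC16 Gd hrGd hC16d K hK hGd ι₃ P' Q hP'
    hQ hI0 hQunit D' hq₀ hq₁ hstep0 hu₀ hu₁ htam hcD').1

/-! ## §4 Composition with GEN 16's W-side chain: KL3-A + Yan–Zhu ⇒ `3 ∤ [W(K) : ℤP_W]` for the (t′) curve -/

/-- **The KL3 chain with an ORDINARY companion, every non-classical input a PUBLISHED theorem taken as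
an explicit hypothesis.** `W` the (t′) curve (`Addv W 3`, `a₃(W) = 0`, `ρ̄_{W,3}` onto, `3 ∤ ∏c_q(W)`),
`G` a globally minimal mod-`3` companion (`a_ℓ(W) ≡ a_ℓ(G) (mod 3)` off `3 N_W N_G`) in row C16 at `3`
(good ORDINARY, irreducible, surj(3) ∨ ram) together with a row-C16 model `Gd` of its `d_K`-twist, both
of analytic rank `≤ 1`; a common Heegner field `K` (`d_K < −4`, `3 ∤ d_K`, `ι₃ : K →+* ℚ₃`), Heegner
points `P ∈ W(K)`, `P′ ∈ G(K)` of infinite order (`P′` of finite index), a `3`-primitive `Q ∈ G(K)`,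
off-`3` depletion factors units on both sides, Manin constants `3`-units, and the census data of the
COMPANION pair (STEP-0, both analytic orders `3`-units, `3 ∤ ∏c_q(G)`). GRANTED Kriz–Li 2019 Thm. 1.16 at
`p = 3`, `m = 1` (`hA`, KL3-A, in print), Yan–Zhu 2026 Thm. 4.15 (`hYZ`), Wuthrich 2014 Lemma 20
(`hW20`), modularity (`hmod`) and Gross–Zagier–Kolyvagin (`hGZK`): `3 ∤ [W(K) : ℤP]`. The W-side is GEN
16's `padicValNat_index_eq_zero_of_companion_unit'`; the companion side is §3. What this is NOT: it is
not KL3-C♭ (whose `Ш`/primitivity hypotheses sit on `W`, not on `G` — moving them across is KL3-B +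
KL3-M, theorem-candidates), and it books nothing. [cite: KrizLi2019, Thm. 1.16, Rem. 1.17]
[cite: YanZhu2024MainConjNonCM, Thm. 4.15 (§4.6) = Cor. 1.4] [cite: GrossLMS1991, §1 Conj. 1.2 (p. 237)] -/
theorem o5_index_unit_of_goodOrd_companion (hA : KrizLiUnitBitTransportThree)
    (hYZ : YanZhu2026.thm415_padicValRat_bsd_rank_le_one)
    (hW20 : Wuthrich2014.lemma20_surjective_threeAdic_of_semistable)
    (hmod : hasEntireLFunction_rat) (hGZK : rank_eq_analyticRank_of_analyticRank_le_one)
    (W G : WeierstrassCurve ℚ) [W.IsElliptic] [W.IsGloballyMinimal] [G.IsElliptic] [G.IsGloballyMinimal]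
    (hcong : ∀ ℓ : ℕ, ℓ.Prime → ¬ (ℓ ∣ 3 * W.conductorNorm ℤ * G.conductorNorm ℤ) →
      ((W.LFunction ℓ : ℤ) : ZMod 3) = ((G.LFunction ℓ : ℤ) : ZMod 3))
    (hρ : W.HasSurjectiveModNGaloisRep 3) (hadd : Addv W 3) (hWa3 : W.LFunction 3 = 0)
    (hNW : W.conductorNorm ℤ ≠ 0) (hNG : G.conductorNorm ℤ ≠ 0)
    (hunitW : ∀ ℓ ∈ klSet W G, ℓ ≠ 3 → padicValInt 3 (nsCount W ℓ) = 0)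
    (hunitG : ∀ ℓ ∈ klSet G W, ℓ ≠ 3 → padicValInt 3 (nsCount G ℓ) = 0)
    (htam : ¬ 3 ∣ W.tamagawaProduct)
    (hrG : G.analyticRank ≤ 1) (hC16 : RowC16 G 3)
    (Gd : WeierstrassCurve ℚ) [Gd.IsElliptic] [Gd.IsGloballyMinimal] (hrGd : Gd.analyticRank ≤ 1)
    (hC16d : RowC16 Gd 3)
    {N N' : ℕ} [NeZero N] [NeZero N'] (D : ModularParametrizationData W N)
    (D' : ModularParametrizationData G N')
    (K : Type) [Field K] [NumberField K] (hK : IsImaginaryQuadratic K)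
    (hH : SatisfiesHeegnerHypothesis N K) (hH' : SatisfiesHeegnerHypothesis N' K)
    (hd : NumberField.discr K < -4) (h3d : ¬ ((3 : ℤ) ∣ NumberField.discr K))
    (hGd : ∃ C : VariableChange ℚ, C • G.quadraticTwist (NumberField.discr K : ℚ) = Gd)
    (H : HeegnerDatum N (NumberField.discr K)) (H' : HeegnerDatum N' (NumberField.discr K))
    (ι : K →+* ℂ) (ι₃ : K →+* ℚ_[3])
    (P : (W.baseChange K).toAffine.Point) (P' Q : (G.baseChange K).toAffine.Point)
    (hP : WeierstrassCurve.Affine.Point.map ι.toRatAlgHom P = heegnerPointComplex D H)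
    (hP' : WeierstrassCurve.Affine.Point.map ι.toRatAlgHom P' = heegnerPointComplex D' H')
    (hPinf : ¬ IsOfFinAddOrder P) (hP'inf : ¬ IsOfFinAddOrder P') (hQ : ¬ IsOfFinAddOrder Q)
    (hI0 : (AddSubgroup.zmultiples P').index ≠ 0)
    (hQunit : padicLogOrd G 3 ι₃ Q + padicValInt 3 (nsCount G 3) - 1 = 0)
    (hcD : padicValInt 3 D.maninConstant = 0) (hcD' : padicValInt 3 D'.maninConstant = 0)
    (htamG : ¬ 3 ∣ G.tamagawaProduct)
    {q₀ q₁ : ℚ} (hq₀ : shaAn G = (q₀ : ℂ)) (hq₁ : shaAn Gd = (q₁ : ℂ))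
    (hstep0 : padicValRat 3 q₀ + padicValRat 3 q₁ + ((2 * padicValNat 3 G.tamagawaProduct : ℕ) : ℤ) +
        ((2 * padicValInt 3 D'.maninConstant : ℕ) : ℤ) =
      ((2 * padicValNat 3 (AddSubgroup.zmultiples P').index : ℕ) : ℤ))
    (hu₀ : padicValRat 3 q₀ = 0) (hu₁ : padicValRat 3 q₁ = 0) :
    padicValNat 3 (AddSubgroup.zmultiples P).index = 0 :=
  padicValNat_index_eq_zero_of_companion_unit' hA W G hcong hρ hadd hWa3 hNW hNG hunitW hunitG htam D D'
    K hK hH hH' hd h3d H H' ι ι₃ P P' hP hP' hPinf hP'inf hcD hcD'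
    (goodOrd_companion_logUnit_three hYZ hW20 hmod hGZK G hrG hC16 Gd hrGd hC16d K hK hGd ι₃ P' Q
      hP'inf hQ hI0 hQunit D' hq₀ hq₁ hstep0 hu₀ hu₁ htamG hcD').1

/-- **§4b: the same chain with the finite-index binder discharged by Kolyvagin's theorem** (`hKo`, tree
named fact `kolyvagin` for the companion `G` over `K` at level `N′`; §1b). Every remaining hypothesis is
either a published theorem taken as an explicit binder (`hA`, `hYZ`, `hW20`, `hmod`, `hGZK`, `hKo`), a
structural datum of the two Heegner pairs, or census data of the COMPANION pair. Books nothing.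
[cite: KrizLi2019, Thm. 1.16, Rem. 1.17] [cite: YanZhu2024MainConjNonCM, Thm. 4.15 (§4.6) = Cor. 1.4]
[cite: Gross1991, Thm. 1.3] -/
theorem o5_index_unit_of_goodOrd_companion_of_kolyvagin (hA : KrizLiUnitBitTransportThree)
    (hYZ : YanZhu2026.thm415_padicValRat_bsd_rank_le_one)
    (hW20 : Wuthrich2014.lemma20_surjective_threeAdic_of_semistable)
    (hmod : hasEntireLFunction_rat) (hGZK : rank_eq_analyticRank_of_analyticRank_le_one)
    (W G : WeierstrassCurve ℚ) [W.IsElliptic] [W.IsGloballyMinimal] [G.IsElliptic] [G.IsGloballyMinimal]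
    (hcong : ∀ ℓ : ℕ, ℓ.Prime → ¬ (ℓ ∣ 3 * W.conductorNorm ℤ * G.conductorNorm ℤ) →
      ((W.LFunction ℓ : ℤ) : ZMod 3) = ((G.LFunction ℓ : ℤ) : ZMod 3))
    (hρ : W.HasSurjectiveModNGaloisRep 3) (hadd : Addv W 3) (hWa3 : W.LFunction 3 = 0)
    (hNW : W.conductorNorm ℤ ≠ 0) (hNG : G.conductorNorm ℤ ≠ 0)
    (hunitW : ∀ ℓ ∈ klSet W G, ℓ ≠ 3 → padicValInt 3 (nsCount W ℓ) = 0)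
    (hunitG : ∀ ℓ ∈ klSet G W, ℓ ≠ 3 → padicValInt 3 (nsCount G ℓ) = 0)
    (htam : ¬ 3 ∣ W.tamagawaProduct)
    (hrG : G.analyticRank ≤ 1) (hC16 : RowC16 G 3)
    (Gd : WeierstrassCurve ℚ) [Gd.IsElliptic] [Gd.IsGloballyMinimal] (hrGd : Gd.analyticRank ≤ 1)
    (hC16d : RowC16 Gd 3)
    {N N' : ℕ} [NeZero N] [NeZero N'] (D : ModularParametrizationData W N)
    (D' : ModularParametrizationData G N')
    (K : Type) [Field K] [NumberField K] (hK : IsImaginaryQuadratic K)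
    (hH : SatisfiesHeegnerHypothesis N K) (hH' : SatisfiesHeegnerHypothesis N' K)
    (hKo : kolyvagin N' G K)
    (hd : NumberField.discr K < -4) (h3d : ¬ ((3 : ℤ) ∣ NumberField.discr K))
    (hGd : ∃ C : VariableChange ℚ, C • G.quadraticTwist (NumberField.discr K : ℚ) = Gd)
    (H : HeegnerDatum N (NumberField.discr K)) (H' : HeegnerDatum N' (NumberField.discr K))
    (ι : K →+* ℂ) (ι₃ : K →+* ℚ_[3])
    (P : (W.baseChange K).toAffine.Point) (P' Q : (G.baseChange K).toAffine.Point)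
    (hP : WeierstrassCurve.Affine.Point.map ι.toRatAlgHom P = heegnerPointComplex D H)
    (hP' : WeierstrassCurve.Affine.Point.map ι.toRatAlgHom P' = heegnerPointComplex D' H')
    (hPinf : ¬ IsOfFinAddOrder P) (hP'inf : ¬ IsOfFinAddOrder P') (hQ : ¬ IsOfFinAddOrder Q)
    (hQunit : padicLogOrd G 3 ι₃ Q + padicValInt 3 (nsCount G 3) - 1 = 0)
    (hcD : padicValInt 3 D.maninConstant = 0) (hcD' : padicValInt 3 D'.maninConstant = 0)
    (htamG : ¬ 3 ∣ G.tamagawaProduct)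
    {q₀ q₁ : ℚ} (hq₀ : shaAn G = (q₀ : ℂ)) (hq₁ : shaAn Gd = (q₁ : ℂ))
    (hstep0 : padicValRat 3 q₀ + padicValRat 3 q₁ + ((2 * padicValNat 3 G.tamagawaProduct : ℕ) : ℤ) +
        ((2 * padicValInt 3 D'.maninConstant : ℕ) : ℤ) =
      ((2 * padicValNat 3 (AddSubgroup.zmultiples P').index : ℕ) : ℤ))
    (hu₀ : padicValRat 3 q₀ = 0) (hu₁ : padicValRat 3 q₁ = 0) :
    padicValNat 3 (AddSubgroup.zmultiples P).index = 0 :=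
  o5_index_unit_of_goodOrd_companion hA hYZ hW20 hmod hGZK W G hcong hρ hadd hWa3 hNW hNG hunitW hunitG
    htam hrG hC16 Gd hrGd hC16d D D' K hK hH hH' hd h3d hGd H H' ι ι₃ P P' Q hP hP' hPinf hP'inf hQ
    (index_zmultiples_ne_zero_of_kolyvagin G K hKo hK hH' ⟨D', H', ι, hP'⟩ hP'inf) hQunit hcD hcD'
    htamG hq₀ hq₁ hstep0 hu₀ hu₁

end Summit.BirchSwinnertonDyer.Rank1Residual.O5.HeegnerLogTransport

end
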